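import Summits.AtomisticToContinuum.FouriersLaw.Theorems.PuiseuxTransferLedgerTwoModeBulkCorrectorIdentity
import Summits.AtomisticToContinuum.FouriersLaw.Theorems.PuiseuxTransferLedgerTwoModeBulkReduction

/-!
# Corrector identity for the two-mode profile, part 5: the crux in corrector form
(helper, `--supports` crux stmt-AtomisticToContinuum-12111 `PuiseuxTransferLedger.TwoModeBulk`, line `Sketch`)

With the corrector identity `u_N(i) = 1/2 - i/N + (N T²)⁻¹ W̃_N(i)`, `W̃_N(i) := ∫₀^∞ Cov_{μ₀}(J, K_s p_i²) ds`
(part 4, `pinnedChain_correctorIdentity`; `J = ∑_b j_b`, `μ₀ = gibbsMeasure (N+1) T`, `K_s = transitionKernel (N+1) T T s`)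
the increments of the explicit profile are `u_N(i) - u_N(i+1) = 1/N - (W̃_N(i+1) - W̃_N(i))/(N T²)`, so the two-mode
property of the profile (`TwoModeProfile`, kernel-checked equivalent to the crux: `twoModeBulk_iff_twoModeProfile`,
p126691) is LITERALLY a two-mode property of the finite-volume Green–Kubo corrector's kinetic profile:

* `twoModeProfile_iff_correctorTwoMode` — `TwoModeProfile ↔ CorrectorTwoMode`, where `CorrectorTwoMode` says: there are
  `r`, `θ ∈ [0,1)`, `C` NOT depending on `N` with
  `|1/N - (W̃_N(i+1) - W̃_N(i))/(N T²) - r g_N| ≤ C |g_N| (θ^i + θ^(N-1-i))` for all `N` and all bonds `(i, i+1)`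
  (`g_N = (γ²/T²)∫₀^∞ Cov_{μ₀}(p_0², K_s p_N²) ds`);
* `twoModeBulk_iff_correctorTwoMode` — hence `TwoModeBulk ↔ CorrectorTwoMode` (crux-strategist census S⁺₅ / D5,
  `Cruxes/TwoModeBulk/STRATEGY-CENSUS.md`): an `N`-uniform engine for the crux is exactly `N`-uniform spatial control of
  the increments of `i ↦ ∫₀^∞ Cov_{μ₀}(J, K_s p_i²) ds` — time-integrated locality of the total-current → site-temperature
  response of the equilibrium open chain.
Both statements are inlined (no definitions); nothing here closes the item.
-/

noncomputable section

open scoped NNReal ENNReal Topology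
open MeasureTheory Filter Set

namespace Summit.AtomisticToContinuum.FouriersLaw.Theorems.TwoModeBulk.Sketch

open Literature.MathematicalPhysics.KineticTheory.HeatConduction

/-- The increment algebra behind the corrector form: with `u = 1/2 - x/N + W/(N T²)` at `x` and `x + 1`,
`u(x) - u(x+1) - ρ = 1/N - (W(x+1) - W(x))/(N T²) - ρ`. [folklore] -/
theorem corrector_increment_algebra (N T x Wi Wj ρ : ℝ) (hN : N ≠ 0) (hT : T ≠ 0) :
    (1 / 2 - x / N + 1 / (N * T ^ 2) * Wi) - (1 / 2 - (x + 1) / N + 1 / (N * T ^ 2) * Wj) - ρ =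
      1 / N - (Wj - Wi) / (N * T ^ 2) - ρ := by
  field_simp
  ring

/-- **`TwoModeProfile ↔ CorrectorTwoMode`**: the two-mode property of the explicit equilibrium Kubo profile
`u_N(i) = (γ/T²)∫₀^∞ Cov_{μ₀}(p_0², K_s p_i²) ds - 1/2` (left) is equivalent to the two-mode property of the increments of
the corrector kernel `i ↦ ∫₀^∞ Cov_{μ₀}(J, K_s p_i²) ds` (right), with the SAME constants `(r, θ, C)`, by the corrector
identity `pinnedChain_correctorIdentity` at the two sites of each bond (`N ≥ 1` as soon as a bond exists). [folklore] -/
theorem twoModeProfile_iff_correctorTwoMode :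
    (∀ ω₂ lam β γ : ℝ, 0 < ω₂ → 0 < lam → 0 < β → 0 < γ → ∀ T : ℝ, 0 < T → ∃ r θ C : ℝ, 0 ≤ θ ∧ θ < 1 ∧ ∀ (N : ℕ) (i j : Fin (N + 1)), j.val = i.val + 1 → |(γ / T ^ 2 * (∫ t in Set.Ioi (0 : ℝ), ((∫ z, (z.2 0) ^ 2 * (∫ y, (y.2 i) ^ 2 ∂((Literature.MathematicalPhysics.KineticTheory.HeatConduction.pinnedChain ω₂ lam β γ).transitionKernel (N + 1) T T t.toNNReal z)) ∂((Literature.MathematicalPhysics.KineticTheory.HeatConduction.pinnedChain ω₂ lam β γ).gibbsMeasure (N + 1) T)) - (∫ z, (z.2 0) ^ 2 ∂((Literature.MathematicalPhysics.KineticTheory.HeatConduction.pinnedChain ω₂ lam β γ).gibbsMeasure (N + 1) T)) * (∫ z, (∫ y, (y.2 i) ^ 2 ∂((Literature.MathematicalPhysics.KineticTheory.HeatConduction.pinnedChain ω₂ lam β γ).transitionKernel (N + 1) T T t.toNNReal z)) ∂((Literature.MathematicalPhysics.KineticTheory.HeatConduction.pinnedChain ω₂ lam β γ).gibbsMeasure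 (N + 1) T)))) - 1 / 2) - (γ / T ^ 2 * (∫ t in Set.Ioi (0 : ℝ), ((∫ z, (z.2 0) ^ 2 * (∫ y, (y.2 j) ^ 2 ∂((Literature.MathematicalPhysics.KineticTheory.HeatConduction.pinnedChain ω₂ lam β γ).transitionKernel (N + 1) T T t.toNNReal z)) ∂((Literature.MathematicalPhysics.KineticTheory.HeatConduction.pinnedChain ω₂ lam β γ).gibbsMeasure (N + 1) T)) - (∫ z, (z.2 0) ^ 2 ∂((Literature.MathematicalPhysics.KineticTheory.HeatConduction.pinnedChain ω₂ lam β γ).gibbsMeasure (N + 1) T)) * (∫ z, (∫ y, (y.2 j) ^ 2 ∂((Literature.MathematicalPhysics.KineticTheory.HeatConduction.pinnedChain ω₂ lam β γ).transitionKernel (N + 1) T T t.toNNReal z)) ∂((Literature.MathematicalPhysics.KineticTheory.HeatConduction.pinnedChain ω₂ lam β γ).gibbsMeasure (N + 1) T)))) - 1 / 2) - r * ((γ ^ 2 / T ^ 2) * ∫ t in Set.Ioi (0 : ℝ), ((∫ z, (z.2 0) ^ 2 * (∫ y, (y.2 (Fin.last N)) ^ 2 ∂((Literature.MathematicalPhysics.KineticTheory.HeatConduction.pinnedChain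 ω₂ lam β γ).transitionKernel (N + 1) T T t.toNNReal z)) ∂((Literature.MathematicalPhysics.KineticTheory.HeatConduction.pinnedChain ω₂ lam β γ).gibbsMeasure (N + 1) T)) - (∫ z, (z.2 0) ^ 2 ∂((Literature.MathematicalPhysics.KineticTheory.HeatConduction.pinnedChain ω₂ lam β γ).gibbsMeasure (N + 1) T)) * (∫ z, (∫ y, (y.2 (Fin.last N)) ^ 2 ∂((Literature.MathematicalPhysics.KineticTheory.HeatConduction.pinnedChain ω₂ lam β γ).transitionKernel (N + 1) T T t.toNNReal z)) ∂((Literature.MathematicalPhysics.KineticTheory.HeatConduction.pinnedChain ω₂ lam β γ).gibbsMeasure (N + 1) T))))| ≤ C * |(γ ^ 2 / T ^ 2) * ∫ t in Set.Ioi (0 : ℝ), ((∫ z, (z.2 0) ^ 2 * (∫ y, (y.2 (Fin.last N)) ^ 2 ∂((Literature.MathematicalPhysics.KineticTheory.HeatConduction.pinnedChain ω₂ lam β γ).transitionKernel (N + 1) T T t.toNNReal z)) ∂((Literature.MathematicalPhysics.KineticTheory.HeatConduction.pinnedChain ω₂ lam β γ).gibbsMeasure (N + 1) T)) - (∫ z,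 (z.2 0) ^ 2 ∂((Literature.MathematicalPhysics.KineticTheory.HeatConduction.pinnedChain ω₂ lam β γ).gibbsMeasure (N + 1) T)) * (∫ z, (∫ y, (y.2 (Fin.last N)) ^ 2 ∂((Literature.MathematicalPhysics.KineticTheory.HeatConduction.pinnedChain ω₂ lam β γ).transitionKernel (N + 1) T T t.toNNReal z)) ∂((Literature.MathematicalPhysics.KineticTheory.HeatConduction.pinnedChain ω₂ lam β γ).gibbsMeasure (N + 1) T)))| * (θ ^ i.val + θ ^ (N - 1 - i.val))) ↔
    (∀ ω₂ lam β γ : ℝ, 0 < ω₂ → 0 < lam → 0 < β → 0 < γ → ∀ T : ℝ, 0 < T → ∃ r θ C : ℝ, 0 ≤ θ ∧ θ < 1 ∧ ∀ (N : ℕ) (i j : Fin (N + 1)), j.val = i.val + 1 → |1 / (N : ℝ) - ((∫ t in Set.Ioi (0 : ℝ), ((∫ z, (∑ b : Fin (N + 1), (Literature.MathematicalPhysics.KineticTheory.HeatConduction.pinnedChain ω₂ lam β γ).bondCurrent (N + 1) b z) * (∫ y, (y.2 j) ^ 2 ∂((Literature.MathematicalPhysics.KineticTheory.HeatConduction.pinnedChain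 ω₂ lam β γ).transitionKernel (N + 1) T T t.toNNReal z)) ∂((Literature.MathematicalPhysics.KineticTheory.HeatConduction.pinnedChain ω₂ lam β γ).gibbsMeasure (N + 1) T)) - (∫ z, (∑ b : Fin (N + 1), (Literature.MathematicalPhysics.KineticTheory.HeatConduction.pinnedChain ω₂ lam β γ).bondCurrent (N + 1) b z) ∂((Literature.MathematicalPhysics.KineticTheory.HeatConduction.pinnedChain ω₂ lam β γ).gibbsMeasure (N + 1) T)) * (∫ z, (∫ y, (y.2 j) ^ 2 ∂((Literature.MathematicalPhysics.KineticTheory.HeatConduction.pinnedChain ω₂ lam β γ).transitionKernel (N + 1) T T t.toNNReal z)) ∂((Literature.MathematicalPhysics.KineticTheory.HeatConduction.pinnedChain ω₂ lam β γ).gibbsMeasure (N + 1) T)))) - (∫ t in Set.Ioi (0 : ℝ), ((∫ z, (∑ b : Fin (N + 1), (Literature.MathematicalPhysics.KineticTheory.HeatConduction.pinnedChain ω₂ lam β γ).bondCurrent (N + 1) b z) * (∫ y, (y.2 i) ^ 2 ∂((Literature.MathematicalPhysics.KineticTheory.HeatConduction.pinnedChain ω₂ lam β γ).transitionKernel (N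 + 1) T T t.toNNReal z)) ∂((Literature.MathematicalPhysics.KineticTheory.HeatConduction.pinnedChain ω₂ lam β γ).gibbsMeasure (N + 1) T)) - (∫ z, (∑ b : Fin (N + 1), (Literature.MathematicalPhysics.KineticTheory.HeatConduction.pinnedChain ω₂ lam β γ).bondCurrent (N + 1) b z) ∂((Literature.MathematicalPhysics.KineticTheory.HeatConduction.pinnedChain ω₂ lam β γ).gibbsMeasure (N + 1) T)) * (∫ z, (∫ y, (y.2 i) ^ 2 ∂((Literature.MathematicalPhysics.KineticTheory.HeatConduction.pinnedChain ω₂ lam β γ).transitionKernel (N + 1) T T t.toNNReal z)) ∂((Literature.MathematicalPhysics.KineticTheory.HeatConduction.pinnedChain ω₂ lam β γ).gibbsMeasure (N + 1) T))))) / (N * T ^ 2) - r * ((γ ^ 2 / T ^ 2) * ∫ t in Set.Ioi (0 : ℝ), ((∫ z, (z.2 0) ^ 2 * (∫ y, (y.2 (Fin.last N)) ^ 2 ∂((Literature.MathematicalPhysics.KineticTheory.HeatConduction.pinnedChain ω₂ lam β γ).transitionKernel (N + 1) T T t.toNNReal z)) ∂((Literature.MathematicalPhysics.KineticTheory.HeatConduction.pinnedChain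 ω₂ lam β γ).gibbsMeasure (N + 1) T)) - (∫ z, (z.2 0) ^ 2 ∂((Literature.MathematicalPhysics.KineticTheory.HeatConduction.pinnedChain ω₂ lam β γ).gibbsMeasure (N + 1) T)) * (∫ z, (∫ y, (y.2 (Fin.last N)) ^ 2 ∂((Literature.MathematicalPhysics.KineticTheory.HeatConduction.pinnedChain ω₂ lam β γ).transitionKernel (N + 1) T T t.toNNReal z)) ∂((Literature.MathematicalPhysics.KineticTheory.HeatConduction.pinnedChain ω₂ lam β γ).gibbsMeasure (N + 1) T))))| ≤ C * |((γ ^ 2 / T ^ 2) * ∫ t in Set.Ioi (0 : ℝ), ((∫ z, (z.2 0) ^ 2 * (∫ y, (y.2 (Fin.last N)) ^ 2 ∂((Literature.MathematicalPhysics.KineticTheory.HeatConduction.pinnedChain ω₂ lam β γ).transitionKernel (N + 1) T T t.toNNReal z)) ∂((Literature.MathematicalPhysics.KineticTheory.HeatConduction.pinnedChain ω₂ lam β γ).gibbsMeasure (N + 1) T)) - (∫ z, (z.2 0) ^ 2 ∂((Literature.MathematicalPhysics.KineticTheory.HeatConduction.pinnedChain ω₂ lam β γ).gibbsMeasure (N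 + 1) T)) * (∫ z, (∫ y, (y.2 (Fin.last N)) ^ 2 ∂((Literature.MathematicalPhysics.KineticTheory.HeatConduction.pinnedChain ω₂ lam β γ).transitionKernel (N + 1) T T t.toNNReal z)) ∂((Literature.MathematicalPhysics.KineticTheory.HeatConduction.pinnedChain ω₂ lam β γ).gibbsMeasure (N + 1) T))))| * (θ ^ i.val + θ ^ (N - 1 - i.val))) := by
  refine forall_congr' fun ω₂ => forall_congr' fun lam => forall_congr' fun β => forall_congr' fun γ => ?_
  refine forall_congr' fun hω => forall_congr' fun hl => forall_congr' fun hβ => forall_congr' fun hγ => ?_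
  refine forall_congr' fun T => forall_congr' fun hT => ?_
  refine exists_congr fun r => exists_congr fun θ => exists_congr fun C => ?_
  refine and_congr_right fun _ => and_congr_right fun _ => ?_
  refine forall_congr' fun N => forall_congr' fun i => forall_congr' fun j => forall_congr' fun hj => ?_
  have hN : 0 < N := by have := j.isLt; omega
  obtain ⟨-, hi⟩ := pinnedChain_correctorIdentity hω hl.le hβ hγ hN hT i
  obtain ⟨-, hj'⟩ := pinnedChain_correctorIdentity hω hl.le hβ hγ hN hT j
  have hjv : ((j.val : ℕ) : ℝ) = ((i.val : ℕ) : ℝ) + 1 := by exact_mod_cast hj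
  have hNr : (N : ℝ) ≠ 0 := by exact_mod_cast hN.ne'
  rw [hi, hj', hjv, corrector_increment_algebra _ _ _ _ _ _ hNr hT.ne']

/-- **The crux in corrector form: `TwoModeBulk ↔ CorrectorTwoMode`** (`twoModeBulk_iff_twoModeProfile`, p126691, then
`twoModeProfile_iff_correctorTwoMode`). [folklore] -/
theorem twoModeBulk_iff_correctorTwoMode :
    Summit.AtomisticToContinuum.FouriersLaw.Theses.PuiseuxTransferLedger.TwoModeBulk ↔ (∀ ω₂ lam β γ : ℝ, 0 < ω₂ → 0 < lam → 0 < β → 0 < γ → ∀ T : ℝ, 0 < T → ∃ r θ C : ℝ, 0 ≤ θ ∧ θ < 1 ∧ ∀ (N : ℕ) (i j : Fin (N + 1)), j.val = i.val + 1 → |1 / (N : ℝ) - ((∫ t in Set.Ioi (0 : ℝ), ((∫ z, (∑ b : Fin (N + 1), (Literature.MathematicalPhysics.KineticTheory.HeatConduction.pinnedChain ω₂ lam β γ).bondCurrent (N + 1) b z) * (∫ y, (y.2 j) ^ 2 ∂((Literature.MathematicalPhysics.KineticTheory.HeatConduction.pinnedChain ω₂ lam β γ).transitionKernel (N + 1)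 T T t.toNNReal z)) ∂((Literature.MathematicalPhysics.KineticTheory.HeatConduction.pinnedChain ω₂ lam β γ).gibbsMeasure (N + 1) T)) - (∫ z, (∑ b : Fin (N + 1), (Literature.MathematicalPhysics.KineticTheory.HeatConduction.pinnedChain ω₂ lam β γ).bondCurrent (N + 1) b z) ∂((Literature.MathematicalPhysics.KineticTheory.HeatConduction.pinnedChain ω₂ lam β γ).gibbsMeasure (N + 1) T)) * (∫ z, (∫ y, (y.2 j) ^ 2 ∂((Literature.MathematicalPhysics.KineticTheory.HeatConduction.pinnedChain ω₂ lam β γ).transitionKernel (N + 1) T T t.toNNReal z)) ∂((Literature.MathematicalPhysics.KineticTheory.HeatConduction.pinnedChain ω₂ lam β γ).gibbsMeasure (N + 1) T)))) - (∫ t in Set.Ioi (0 : ℝ), ((∫ z, (∑ b : Fin (N + 1), (Literature.MathematicalPhysics.KineticTheory.HeatConduction.pinnedChain ω₂ lam β γ).bondCurrent (N + 1) b z) * (∫ y, (y.2 i) ^ 2 ∂((Literature.MathematicalPhysics.KineticTheory.HeatConduction.pinnedChain ω₂ lam β γ).transitionKernel (N + 1) T T t.toNNReal z)) ∂((Literature.MathematicalPhysics.KineticTheory.HeatConduction.pinnedChain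 ω₂ lam β γ).gibbsMeasure (N + 1) T)) - (∫ z, (∑ b : Fin (N + 1), (Literature.MathematicalPhysics.KineticTheory.HeatConduction.pinnedChain ω₂ lam β γ).bondCurrent (N + 1) b z) ∂((Literature.MathematicalPhysics.KineticTheory.HeatConduction.pinnedChain ω₂ lam β γ).gibbsMeasure (N + 1) T)) * (∫ z, (∫ y, (y.2 i) ^ 2 ∂((Literature.MathematicalPhysics.KineticTheory.HeatConduction.pinnedChain ω₂ lam β γ).transitionKernel (N + 1) T T t.toNNReal z)) ∂((Literature.MathematicalPhysics.KineticTheory.HeatConduction.pinnedChain ω₂ lam β γ).gibbsMeasure (N + 1) T))))) / (N * T ^ 2) - r * ((γ ^ 2 / T ^ 2) * ∫ t in Set.Ioi (0 : ℝ), ((∫ z, (z.2 0) ^ 2 * (∫ y, (y.2 (Fin.last N)) ^ 2 ∂((Literature.MathematicalPhysics.KineticTheory.HeatConduction.pinnedChain ω₂ lam β γ).transitionKernel (N + 1) T T t.toNNReal z)) ∂((Literature.MathematicalPhysics.KineticTheory.HeatConduction.pinnedChain ω₂ lam β γ).gibbsMeasure (N + 1) T)) - (∫ z, (z.2 0) ^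 2 ∂((Literature.MathematicalPhysics.KineticTheory.HeatConduction.pinnedChain ω₂ lam β γ).gibbsMeasure (N + 1) T)) * (∫ z, (∫ y, (y.2 (Fin.last N)) ^ 2 ∂((Literature.MathematicalPhysics.KineticTheory.HeatConduction.pinnedChain ω₂ lam β γ).transitionKernel (N + 1) T T t.toNNReal z)) ∂((Literature.MathematicalPhysics.KineticTheory.HeatConduction.pinnedChain ω₂ lam β γ).gibbsMeasure (N + 1) T))))| ≤ C * |((γ ^ 2 / T ^ 2) * ∫ t in Set.Ioi (0 : ℝ), ((∫ z, (z.2 0) ^ 2 * (∫ y, (y.2 (Fin.last N)) ^ 2 ∂((Literature.MathematicalPhysics.KineticTheory.HeatConduction.pinnedChain ω₂ lam β γ).transitionKernel (N + 1) T T t.toNNReal z)) ∂((Literature.MathematicalPhysics.KineticTheory.HeatConduction.pinnedChain ω₂ lam β γ).gibbsMeasure (N + 1) T)) - (∫ z, (z.2 0) ^ 2 ∂((Literature.MathematicalPhysics.KineticTheory.HeatConduction.pinnedChain ω₂ lam β γ).gibbsMeasure (N + 1) T)) * (∫ z, (∫ y, (y.2 (Fin.last N)) ^ 2 ∂((Literature.MathematicalPhysics.KineticTheory.HeatConduction.pinnedChain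 ω₂ lam β γ).transitionKernel (N + 1) T T t.toNNReal z)) ∂((Literature.MathematicalPhysics.KineticTheory.HeatConduction.pinnedChain ω₂ lam β γ).gibbsMeasure (N + 1) T))))| * (θ ^ i.val + θ ^ (N - 1 - i.val))) :=
  twoModeBulk_iff_twoModeProfile.trans twoModeProfile_iff_correctorTwoMode

end Summit.AtomisticToContinuum.FouriersLaw.Theorems.TwoModeBulk.Sketch

end
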